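import Summits.ResolutionOfSingularities.ResolutionOfSingularities.Theorems.FrobeniusClosingPatchingRelPerfectDepthPhaseCLocalGamePatchGlue
import Literature.AlgebraicGeometry.Resolution.BlowupSequencesAppend
import HarnessLib

/-!
# [OURS · L1 W5.2 · (β-AX) X3 C-I (G-T) (iv′)] Sequential patching, II: ORDER REDUCTION FROM ONE-PATCH CURES OF DISJOINT CLOSED PIECES

Sub-problem `ResolutionOfSingularities`, crux `PatchingRelPerfect` (stmt-ResolutionOfSingularities-16161), line
`Cruxes/PatchingRelPerfect/Lines/closed_point_slice.lean`, engine (G2), Prop `X3LemmaM.EndOrderReduction m` of `…DepthPhaseCX3Defs`.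
Object (iv′) (res-D-pv-046 21:29:08Z (3), res-L1-w52-lead-1 R13-4 (2)): Bierstone–Milman's SEQUENTIAL chart-by-chart gluing
[BM 2006, Lemma 8.7; proof of Thm. 8.5, Step 1 «Number the maximal cones σ⁽¹⁾, σ⁽²⁾, …; each centre of blowing up has empty
intersection with the inverse image of U_{σ⁽¹⁾}»] in the regime where it is sound for the END notion of record (H-pt): the top locus
`Sing(K, m)` is a disjoint union of finitely many CLOSED pieces `P i`, and over every open patch containing `P i` and missing the
other pieces a ONE-PATCH order reduction is available (hypothesis schema `hcure`: regular centres over the piece, regular top, a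
factorization `(K|_Y)·𝒪 = M · K₁` with `M` effective Cartier cosupported over the piece, `ord K₁ < m` and `K₁` locally END over the
piece).  THEN the conclusion of `EndOrderReduction m` holds for `K`: **`endOrderReduction_of_closedPieces`**.

Proof: induction over the pieces with a forbidden closed set (the shape of `goodEnd_of_closedPieces_aux`): cure `P 0` on
`U := X ∖ (D ∪ ⋃_{k ≥ 1} P k)`, extend by `CentreSeqExtend.extend`, transfer the factorization package by
`exists_factorization_extend` (part I), recurse on the colon factor `K₁'` with the transported pieces, and compose the two stages
(`centreSeq_exists_two_stage`, `IsEffectiveCartier.comap_centreSeqComp`, `.mul`).  The residual case (iii′) — pieces of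
`Sing(K, m)` inside no single presentation patch — is NOT treated here.

## References
* E. Bierstone, P. Milman, *Desingularization of toric and binomial varieties*, J. Algebraic Geom. 15 (2006), arXiv:math/0411340,
  Lemma 8.7; proof of Thm. 8.5, Step 1. [BierstoneMilman2006]
* U. Görtz, T. Wedhorn, *Algebraic Geometry I* (2nd ed. 2020), Prop. 13.91 (1)–(3). [GortzWedhorn2020]
* The Stacks Project, Tag 0809. [StacksProject]
-/

-- `Summit.<Summit>.<Sub>.Theorems` with `Sub = Summit` (single-conjunct summit, D-0017)
set_option linter.dupNamespace false

noncomputable section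

namespace Summit.ResolutionOfSingularities.ResolutionOfSingularities.Theorems.X3LemmaM

open CategoryTheory AlgebraicGeometry TopologicalSpace IsLocalRing
open Literature.AlgebraicGeometry.Resolution
open Scheme.IdealSheafData

universe u

/-- [OURS · L1 W5.2 · (iv′)] **ORDER REDUCTION FROM ONE-PATCH CURES, inductive form** (finitely many indexed pairwise disjoint closed
pieces inside a set `T`, a forbidden closed set `D`; `K` of order `< m` off the pieces and locally END on its cosupport).
[cite: BierstoneMilman2006, Lemma 8.7; proof of Thm. 8.5, Step 1] [cite: GortzWedhorn2020, Prop. 13.91 (1)–(3)] -/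
theorem endOrderReduction_of_closedPieces_aux : ∀ (n : ℕ) {X : Scheme.{u}} [IsNoetherian X] (_ : Scheme.IsRegular X)
    (K : X.IdealSheafData) (𝓛₀ : List X.IdealSheafData) (m : ℕ) (T D : Set X) (_ : IsClosed D) (P : Fin n → Closeds X),
    (∀ i k, i ≠ k → Disjoint (P i : Set X) (P k)) → (∀ i, Disjoint (P i : Set X) D) → (∀ i, (P i : Set X) ⊆ T) →
    (∀ x, (∀ i, x ∉ (P i : Set X)) → idealOrder K x < m) →
    (∀ x ∈ (K.support : Set X), IsEndNear K 𝓛₀ x) →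
    (∀ i, ∀ (Y : Scheme.{u}) [IsNoetherian Y] (g : Y ⟶ X) [IsOpenImmersion g], (P i : Set X) ⊆ Set.range g.base →
      Disjoint (Set.range g.base) D → (∀ k, k ≠ i → Disjoint (Set.range g.base) (P k)) →
      ∃ s : CentreSeq Y, s.AllRegular ∧ s.CentresOver (g.base ⁻¹' (P i)) ∧ Scheme.IsRegular s.top ∧
        ∃ (M K₁ : s.top.IdealSheafData) (𝓛' : List s.top.IdealSheafData),
          (K.comap g).comap s.comp = M * K₁ ∧ IsEffectiveCartier M ∧
          (M.support : Set s.top) ⊆ s.comp.base ⁻¹' (g.base ⁻¹' (P i)) ∧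
          (∀ y, g.base (s.comp.base y) ∈ (P i : Set X) → idealOrder K₁ y < m) ∧
          (∀ y ∈ (K₁.support : Set s.top), g.base (s.comp.base y) ∈ (P i : Set X) → IsEndNear K₁ 𝓛' y)) →
    ∃ c : CentreSeq X, c.AllRegular ∧ c.CentresOver T ∧ Scheme.IsRegular c.top ∧
      ∃ (_ : IsNoetherian c.top) (M K₁ : c.top.IdealSheafData) (𝓛₁ : List c.top.IdealSheafData),
        K.comap c.comp = M * K₁ ∧ IsEffectiveCartier M ∧ (∀ x, idealOrder K₁ x < m) ∧
        (∀ x ∈ (K₁.support : Set c.top), IsEndNear K₁ 𝓛₁ x) ∧ (K₁.support : Set c.top) ⊆ c.comp.base ⁻¹' K.support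
  | 0, X, _, hX, K, 𝓛₀, m, T, D, _, P, _, _, _, hord, hend, _ => by
    refine ⟨.nil X, trivial, trivial, hX, (inferInstance : IsNoetherian X), ⊤, K, 𝓛₀, ?_, isEffectiveCartier_top,
      fun x => hord x fun i => i.elim0, hend, fun x hx => hx⟩
    change K.comap (𝟙 X) = ⊤ * K
    rw [Scheme.IdealSheafData.comap_id, Scheme.IdealSheafData.top_mul]
  | n + 1, X, _, hX, K, 𝓛₀, m, T, D, hD, P, hdisj, hPD, hPT, hord, hend, hcure => by
    -- the piece `P 0`, cured on the open `U := X ∖ (D ∪ ⋃_{k ≥ 1} P k)`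
    set R : Set X := ⋃ k : Fin n, (P k.succ : Set X) with hRdef
    have hRc : IsClosed R := isClosed_iUnion_of_finite fun k => (P k.succ).isClosed
    set U : X.Opens := ⟨(D ∪ R)ᶜ, (hD.union hRc).isOpen_compl⟩ with hUdef
    haveI : CompactSpace (U : Scheme.{u}) :=
      isCompact_iff_compactSpace.mp (TopologicalSpace.NoetherianSpace.isCompact (U : Set X))
    haveI : IsNoetherian (U : Scheme.{u}) := ⟨⟩
    have hP0U : (P 0 : Set X) ⊆ Set.range U.ι.base := by
      rw [Scheme.Opens.range_ι]
      intro x hx h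
      rcases h with h | h
      · exact Set.disjoint_left.mp (hPD 0) hx h
      · obtain ⟨k, hk⟩ := Set.mem_iUnion.mp h
        exact Set.disjoint_left.mp (hdisj 0 k.succ (Fin.succ_ne_zero k).symm) hx hk
    have hnot : ∀ x, x ∉ (P 0 : Set X) → x ∉ R → ∀ i, x ∉ (P i : Set X) := fun x hx0 hxR i =>
      Fin.cases hx0 (fun k hk => hxR (Set.mem_iUnion.mpr ⟨k, hk⟩)) i
    obtain ⟨s, hsreg, hsover, hstop, M, K₁, 𝓛', hfac, hM, hMZ, hK₁ord, hK₁end⟩ := hcure 0 U U.ι hP0U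
      (by rw [Scheme.Opens.range_ι]; exact Set.disjoint_left.mpr fun x hx hxD => hx (Or.inl hxD))
      (by
        intro k hk
        rw [Scheme.Opens.range_ι]
        refine Set.disjoint_left.mpr fun x hx hxk => hx (Or.inr ?_)
        obtain ⟨k', rfl⟩ := Fin.exists_succ_eq.mpr hk
        exact Set.mem_iUnion.mpr ⟨k', hxk⟩)
    -- extend it to `X` and transfer the factorization package
    set c₁ := CentreSeqExtend.extend s U.ι with hc₁def
    have hc₁reg : c₁.AllRegular := CentreSeqExtend.allRegular_extend s U.ι (P 0).isClosed hP0U hsover hsreg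
    have hc₁over : c₁.CentresOver (P 0 : Set X) := CentreSeqExtend.centresOver_extend s U.ι (P 0).isClosed hsover
    have hc₁top : Scheme.IsRegular c₁.top := CentreSeqExtend.isRegular_top_of_allRegular _ hX hc₁reg
    haveI hc₁N : IsNoetherian c₁.top := CentreSeq.isNoetherian_top c₁
    obtain ⟨M₁, K₁', 𝓛₁, hfac₁, hM₁, hM₁Z, hord₁, hend₁, hsupp₁⟩ := exists_factorization_extend s U.ι (Z := (P 0 : Set X))
      (R := R) (P 0).isClosed hP0U hsover K 𝓛₀ m (fun x hx _ => hend x hx) (fun x hx0 hxR => hord x (hnot x hx0 hxR))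
      M K₁ 𝓛' hfac hM hMZ hK₁ord hK₁end
    -- the remaining pieces, transported to `c₁.top`, for the colon factor `K₁'`
    set P₁ : Fin n → Closeds c₁.top := fun k =>
      ⟨c₁.comp.base ⁻¹' (P k.succ : Set X), (P k.succ).isClosed.preimage c₁.comp.continuous⟩ with hP₁def
    have hD₁ : IsClosed (c₁.comp.base ⁻¹' (D ∪ (P 0 : Set X))) := (hD.union (P 0).isClosed).preimage c₁.comp.continuous
    obtain ⟨c₂, hc₂reg, hc₂over, hc₂top, hc₂N, M₂, K₂, 𝓛₂, hfac₂, hM₂, hord₂, hend₂, hsupp₂⟩ :=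
      endOrderReduction_of_closedPieces_aux n hc₁top K₁' 𝓛₁ m (c₁.comp.base ⁻¹' T) (c₁.comp.base ⁻¹' (D ∪ (P 0 : Set X)))
      hD₁ P₁
      (fun i k hik => (hdisj i.succ k.succ fun h => hik (Fin.succ_injective _ h)).preimage _)
      (fun i => Set.disjoint_left.mpr fun y hy hyD => by
        rcases hyD with h | h
        · exact Set.disjoint_left.mp (hPD i.succ) hy h
        · exact Set.disjoint_left.mp (hdisj i.succ 0 (Fin.succ_ne_zero i)) hy h)
      (fun i => Set.preimage_mono (hPT i.succ))
      (fun y hy => hord₁ y fun hyR => by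
        obtain ⟨k, hk⟩ := Set.mem_iUnion.mp hyR
        exact hy k hk)
      hend₁
      (by
        intro i Y _ g₁ _ hPi hgD hgk
        -- compose with `c₁.comp`: an open immersion into `X` (its range misses `P 0`)
        have hrange : Set.range (g₁ ≫ c₁.comp).base ⊆ (P 0 : Set X)ᶜ := by
          rintro _ ⟨y, rfl⟩ h
          exact Set.disjoint_left.mp hgD ⟨y, rfl⟩ (Or.inr h)
        haveI := centreSeq_isOpenImmersion_comp_of_range_subset c₁ (P 0).isClosed hc₁over g₁ hrange
        -- `M₁` is the unit ideal on the range of `g₁`, so `K·𝒪|_Y = K₁'|_Y`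
        have hM₁g : M₁.comap g₁ = ⊤ := comap_eq_top_of_support_subset hM₁Z g₁ (by
          rintro _ ⟨y, rfl⟩ h
          exact Set.disjoint_left.mp hgD ⟨y, rfl⟩ (Or.inr h))
        have hKg : K.comap (g₁ ≫ c₁.comp) = K₁'.comap g₁ := by
          rw [Scheme.IdealSheafData.comap_comp, hfac₁, comap_mul, hM₁g, Scheme.IdealSheafData.top_mul]
        have hpre : (g₁ ≫ c₁.comp).base ⁻¹' (P i.succ : Set X) = g₁.base ⁻¹' (P₁ i : Set c₁.top) := by
          rw [Scheme.Hom.comp_base, TopCat.coe_comp, Set.preimage_comp]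
          rfl
        obtain ⟨t, htreg, htover, httop, Mt, Kt, 𝓛t, hfact, hMt, hMtZ, hordt, hendt⟩ := hcure i.succ Y (g₁ ≫ c₁.comp)
          (by
            intro x hx
            have hx0 : x ∉ (P 0 : Set X) := fun h => Set.disjoint_left.mp (hdisj i.succ 0 (Fin.succ_ne_zero i)) hx h
            obtain ⟨y₁, hy₁⟩ := centreSeq_exists_eq_comp_of_not_mem c₁ (P 0).isClosed hc₁over hx0
            obtain ⟨y, hy⟩ := hPi (show y₁ ∈ (P₁ i : Set c₁.top) by
              change c₁.comp.base y₁ ∈ (P i.succ : Set X); rw [hy₁]; exact hx)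
            exact ⟨y, by rw [Scheme.Hom.comp_apply, hy, hy₁]⟩)
          (Set.disjoint_left.mpr fun x ⟨y, hy⟩ hxD =>
            Set.disjoint_left.mp hgD ⟨y, rfl⟩ (Or.inl (by rw [← hy] at hxD; exact hxD)))
          (by
            intro k hk
            refine Set.disjoint_left.mpr ?_
            rintro _ ⟨y, rfl⟩ hxk
            rcases Fin.eq_zero_or_eq_succ k with rfl | ⟨k', rfl⟩
            · exact Set.disjoint_left.mp hgD ⟨y, rfl⟩ (Or.inr hxk)
            · exact Set.disjoint_left.mp (hgk k' fun h' => hk (by rw [h'])) ⟨y, rfl⟩ hxk)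
        rw [hKg] at hfact
        refine ⟨t, htreg, by rwa [hpre] at htover, httop, Mt, Kt, 𝓛t, hfact, hMt, ?_, fun y hy => hordt y hy,
          fun y hy hyP => hendt y hy hyP⟩
        intro y hy
        have := hMtZ hy
        rwa [Set.mem_preimage, hpre] at this)
    -- one sequence; compose the factorizations
    have hK₁'K : (K₁'.support : Set c₁.top) ⊆ (K.comap c₁.comp).support :=
      fun y hy => by rw [Scheme.IdealSheafData.support_comap]; exact hsupp₁ hy
    obtain ⟨c, hcreg, hcover, hctop, hcQ⟩ := centreSeq_exists_two_stage
      (fun Y J => ∃ (_ : IsNoetherian Y) (M' K' : Y.IdealSheafData) (𝓛'' : List Y.IdealSheafData),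
        J = M' * K' ∧ IsEffectiveCartier M' ∧ (∀ y, idealOrder K' y < m) ∧
        (∀ y ∈ (K'.support : Set Y), IsEndNear K' 𝓛'' y) ∧ (K'.support : Set Y) ⊆ J.support)
      c₁ K T hc₁reg (hc₁over.mono _ (hPT 0)) c₂ hc₂reg hc₂over hc₂top
      (by
        refine ⟨hc₂N, M₁.comap c₂.comp * M₂, K₂, 𝓛₂, ?_, (hM₁.comap_centreSeqComp c₂).mul hM₂, hord₂, hend₂, ?_⟩
        · rw [Scheme.IdealSheafData.comap_comp, hfac₁, comap_mul, hfac₂, mul_assoc]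
        · intro y hy
          have h1 : c₂.comp.base y ∈ ((K.comap c₁.comp).support : Set c₁.top) := hK₁'K (hsupp₂ hy)
          rw [Scheme.IdealSheafData.comap_comp]
          exact (mem_support_comap_iff c₂.comp _ y).mpr h1)
    obtain ⟨hcN, M', K', 𝓛'', hfac', hM', hord', hend', hsupp'⟩ := hcQ
    refine ⟨c, hcreg, hcover, hctop, hcN, M', K', 𝓛'', hfac', hM', hord', hend', fun y hy => ?_⟩
    have := hsupp' hy
    rwa [Scheme.IdealSheafData.support_comap] at this

/-- [OURS · L1 W5.2 · F7(β) (β-AX) X3 C-I (G-T) (iv′)] **ORDER REDUCTION FROM ONE-PATCH CURES OF DISJOINT CLOSED PIECES** — the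
conclusion of `EndOrderReduction m` for `K` on the regular Noetherian `X`, GIVEN: global letters `𝓛₀` with `K` locally END on its
cosupport; pairwise disjoint closed pieces `P i ⊆ Sing(K, m)` covering `Sing(K, m) = singGE K m`; and for every piece the ONE-PATCH
CURE SCHEMA `hcure` — on every Noetherian `Y` with an open immersion `g : Y ⟶ X` whose range contains the piece and misses the other
pieces, a blow-up sequence of `Y` with regular centres over the piece and regular top, and a factorization `(K|_Y)·𝒪 = M · K₁` with
`M` effective Cartier cosupported over the piece, `ord K₁ < m` over the piece and `K₁` locally END over the piece (letters arbitrary).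
This is Bierstone–Milman's sequential gluing of chart-wise resolutions in the regime sound under (H-pt) (pieces closed, each inside one
patch); the residual case (iii′) is not covered. [cite: BierstoneMilman2006, Lemma 8.7; proof of Thm. 8.5, Step 1]
[cite: GortzWedhorn2020, Prop. 13.91 (1)–(3)] -/
theorem endOrderReduction_of_closedPieces {X : Scheme.{u}} [IsNoetherian X] (hX : Scheme.IsRegular X) (K : X.IdealSheafData)
    (𝓛₀ : List X.IdealSheafData) (m : ℕ) {n : ℕ} (P : Fin n → Closeds X)
    (hdisj : ∀ i k, i ≠ k → Disjoint (P i : Set X) (P k)) (hPK : ∀ i, (P i : Set X) ⊆ singGE K m)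
    (hcov : singGE K m ⊆ ⋃ i, (P i : Set X)) (hend : ∀ x ∈ (K.support : Set X), IsEndNear K 𝓛₀ x)
    (hcure : ∀ i, ∀ (Y : Scheme.{u}) [IsNoetherian Y] (g : Y ⟶ X) [IsOpenImmersion g], (P i : Set X) ⊆ Set.range g.base →
      (∀ k, k ≠ i → Disjoint (Set.range g.base) (P k)) →
      ∃ s : CentreSeq Y, s.AllRegular ∧ s.CentresOver (g.base ⁻¹' (P i)) ∧ Scheme.IsRegular s.top ∧
        ∃ (M K₁ : s.top.IdealSheafData) (𝓛' : List s.top.IdealSheafData),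
          (K.comap g).comap s.comp = M * K₁ ∧ IsEffectiveCartier M ∧
          (M.support : Set s.top) ⊆ s.comp.base ⁻¹' (g.base ⁻¹' (P i)) ∧
          (∀ y, g.base (s.comp.base y) ∈ (P i : Set X) → idealOrder K₁ y < m) ∧
          (∀ y ∈ (K₁.support : Set s.top), g.base (s.comp.base y) ∈ (P i : Set X) → IsEndNear K₁ 𝓛' y)) :
    ∃ s : CentreSeq X, s.AllRegular ∧ s.CentresOver (singGE K m) ∧ Scheme.IsRegular s.top ∧
      ∃ (_ : IsNoetherian s.top) (M K₁ : s.top.IdealSheafData) (𝓛₁ : List s.top.IdealSheafData),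
        K.comap s.comp = M * K₁ ∧ IsEffectiveCartier M ∧ (∀ x : s.top, idealOrder K₁ x < (m : ℕ∞)) ∧
        (∀ x ∈ (K₁.support : Set s.top), IsEndNear K₁ 𝓛₁ x) ∧
        (K₁.support : Set s.top) ⊆ s.comp ⁻¹' (K.support : Set X) := by
  refine endOrderReduction_of_closedPieces_aux n hX K 𝓛₀ m (singGE K m) ∅ isClosed_empty P hdisj
    (fun _ => Set.disjoint_empty _) hPK (fun x hx => ?_) hend fun i Y _ g _ hPi _ hgk => hcure i Y g hPi hgk
  have hxS : x ∉ singGE K m := fun h => by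
    obtain ⟨i, hi⟩ := Set.mem_iUnion.mp (hcov h)
    exact hx i hi
  by_contra hlt
  exact hxS ((MarkedIdeal.mem_support_iff (⟨K, [], m⟩ : MarkedIdeal X) x).mpr
    ((le_idealOrder_iff K x m).mp (not_lt.mp hlt)))

end Summit.ResolutionOfSingularities.ResolutionOfSingularities.Theorems.X3LemmaM

end
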